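import Summits.Ventures.QEC.Census.OrbitBZCoverWit
import HarnessLib

/-!
# Witnessed translation-orbit label cover, PACKED form (qec-search-10 g3): the per-label witnesses of
# `Census/OrbitBZCoverWit.lean` as ONE numeral per chunk (base-256 digits, least significant first)

`coverAutWitRangeOK` takes the witnesses as a `List ℕ` literal (16384 entries ≈ 550 source lines per chunk); for the
`k = 16 / 18` census rows (4 / 16 chunks) the same witnesses packed into a numeral `ws = Σ wᵢ·256^i` keep the data files
few: `coverAutWitPackOK ℓ m Ld L taus blocks lo cnt ws` checks labels `lo … lo + cnt − 1`, reading digit `i` of `ws` as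
the witness of label `lo + i` (`0` = direct, `j + 1` = translation `taus[j]`). Soundness = `coverLabels_of_witPackOK`
(⇒ `CoverLabels … lo (lo + cnt)`, glued by `CoverLabels.append`, closed by `coverAutWit_hcover`). HONEST FRAMING:
infrastructure only; tier KERNEL, axioms standard. [folklore]
-/

namespace Summit.Ventures.QEC.Census

/-- Labels `lam … lam + cnt − 1` against base-256 packed witnesses (structural on `cnt`). (definition) -/
def coverWitGoN (cm : ℕ) (tabs : List (List ℕ)) : ℕ → ℕ → ℕ → Bool
  | _, _, 0 => true
  | lam, ws, cnt + 1 => coverWitStep cm tabs lam (ws % 256) && coverWitGoN cm tabs (lam + 1) (ws / 256) cnt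

/-- **Packed chunk check**: listed translations in range, and labels `[lo, lo + cnt)` pass with the packed witnesses `ws`.
(definition) -/
def coverAutWitPackOK (ℓ m : ℕ) (Ld L : List ℕ) (taus : List (ℕ × ℕ)) (blocks : List BZBlock)
    (lo cnt ws : ℕ) : Bool :=
  (taus.all fun t => decide (t.1 < ℓ) && decide (t.2 < m)) &&
    coverWitGoN (coverMask blocks) (taus.map fun t => rhoCols ℓ m Ld L t) lo ws cnt

/-- The packed driver is sound for its label range. -/
theorem coverWitGoN_sound {ℓ m : ℕ} {Ld L : List ℕ} {taus : List (ℕ × ℕ)} {blocks : List BZBlock} :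
    ∀ (cnt lo ws : ℕ),
      coverWitGoN (coverMask blocks) (taus.map fun t => rhoCols ℓ m Ld L t) lo ws cnt = true →
        CoverLabels ℓ m Ld L taus blocks lo (lo + cnt)
  | 0, lo, _, _ => fun _ h1 h2 => absurd h2 (by simpa using h1)
  | cnt + 1, lo, ws, h => by
    simp only [coverWitGoN, Bool.and_eq_true] at h
    intro lam h1 h2
    rcases Nat.eq_or_lt_of_le h1 with rfl | hlt
    · exact coverWitStep_sound h.1
    · exact coverWitGoN_sound cnt (lo + 1) (ws / 256) h.2 lam hlt (by omega)

/-- **Packed chunk ⇒ property**: `coverAutWitPackOK … lo cnt ws` covers `[lo, lo + cnt)`. -/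
theorem coverLabels_of_witPackOK {ℓ m : ℕ} {Ld L : List ℕ} {taus : List (ℕ × ℕ)} {blocks : List BZBlock}
    {lo cnt ws : ℕ} (h : coverAutWitPackOK ℓ m Ld L taus blocks lo cnt ws = true) :
    CoverLabels ℓ m Ld L taus blocks lo (lo + cnt) := by
  simp only [coverAutWitPackOK, Bool.and_eq_true] at h
  exact coverWitGoN_sound cnt lo ws h.2

/-- The packed chunk check also certifies that the listed translations are in range. -/
theorem taus_ok_of_witPackOK {ℓ m : ℕ} {Ld L : List ℕ} {taus : List (ℕ × ℕ)} {blocks : List BZBlock}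
    {lo cnt ws : ℕ} (h : coverAutWitPackOK ℓ m Ld L taus blocks lo cnt ws = true) :
    (taus.all fun t => decide (t.1 < ℓ) && decide (t.2 < m)) = true := by
  simp only [coverAutWitPackOK, Bool.and_eq_true] at h
  exact h.1

/-- Control: label 1 of `k = 1`, one block spanning it, witness digit `0` (direct): pass. -/
example : coverAutWitPackOK 1 2 [3] [3] [(0, 1)] [⟨[1], []⟩] 1 1 0 = true := by decide

/-- Control: no blocks: fail whatever the packed witness says. -/
example : coverAutWitPackOK 1 2 [3] [3] [(0, 1)] [] 1 1 1 = false := by decide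

end Summit.Ventures.QEC.Census
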